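import Mathlib.RingTheory.Localization.AtPrime.Basic
import Mathlib.RingTheory.Localization.Ideal
import HarnessLib

/-!
# Crux `FrobeniusLadder.FRationalResolution` (stmt-ResolutionOfSingularities-15317), line `redirect`,
# stub `stub_diagonalizableQuotientResolution` — ideals that agree up to saturation by elements
# outside `𝔮` have the same extension to `R_𝔮` (identifying Kato's ideal with the contracted stratum
# ideal on the invariant neighbourhood; memo MEMO-15317-leafhand2-g3 §6–§7, packaging step)

On the invariant neighbourhood three ideals of `S₀` occur at a prime `𝔮'`: Kato's ideal `K` (span of
the degree-zero monomials in `(x_I)`), `J₀ = (x_I)S ∩ S₀` and `J' = (x_I)S[e⁻¹] ∩ S₀`, with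
`K ⊆ J₀ ⊆ J'`, `g • J₀ ⊆ K` (`…FixedPointContraction`) and `J'` the `e`-saturation of `J₀`; since
`g, e ∉ 𝔮'` all three generate the same ideal of `(S₀)_𝔮'`. The generic statement:

* **`map_eq_map_of_forall_exists_mul_mem`** — if `I₁ ≤ I₂` and every `r ∈ I₂` has `t r ∈ I₁` for some
  `t ∉ 𝔮`, then `I₁ R_𝔮 = I₂ R_𝔮` (any localization at `𝔮`);
* `map_eq_map_of_mul_le` — the special case `t • I₂ ⊆ I₁` for one `t ∉ 𝔮`;
* `map_eq_map_of_pow_mul_mem` — the special case of a saturation `{r | ∃ m, t^m r ∈ I₁}`.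

Honest label: plumbing brick (no stub closed). No definitions, no named facts, no sorry. [folklore]
-/

noncomputable section

-- single-problem summit: the doubled namespace component is forced
set_option linter.dupNamespace false

namespace Summit.ResolutionOfSingularities.ResolutionOfSingularities.Theorems.FRationalResolution.SaturatedIdealsLocalize

universe u v

variable {R : Type u} [CommRing R] (𝔮 : Ideal R) [𝔮.IsPrime]
  (Rq : Type v) [CommRing Rq] [Algebra R Rq] [IsLocalization.AtPrime Rq 𝔮]

/-- **Ideals agreeing up to multipliers outside `𝔮` have the same extension to `R_𝔮`.** [folklore] -/
theorem map_eq_map_of_forall_exists_mul_mem {I₁ I₂ : Ideal R} (hle : I₁ ≤ I₂)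
    (hsat : ∀ r ∈ I₂, ∃ t ∉ 𝔮, t * r ∈ I₁) :
    I₁.map (algebraMap R Rq) = I₂.map (algebraMap R Rq) := by
  refine le_antisymm (Ideal.map_mono hle) ?_
  refine Ideal.map_le_iff_le_comap.mpr fun r hr => ?_
  obtain ⟨t, ht, htr⟩ := hsat r hr
  rw [Ideal.mem_comap]
  have hunit : IsUnit (algebraMap R Rq t) :=
    IsLocalization.map_units Rq (⟨t, ht⟩ : 𝔮.primeCompl)
  have hmem : algebraMap R Rq t * algebraMap R Rq r ∈ I₁.map (algebraMap R Rq) := by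
    rw [← map_mul]
    exact Ideal.mem_map_of_mem _ htr
  obtain ⟨w, hw⟩ := hunit.exists_left_inv
  have h := Ideal.mul_mem_left _ w hmem
  rwa [← mul_assoc, hw, one_mul] at h

/-- Special case: one multiplier `t ∉ 𝔮` with `t • I₂ ⊆ I₁`. [folklore] -/
theorem map_eq_map_of_mul_le {I₁ I₂ : Ideal R} (hle : I₁ ≤ I₂) (t : R) (ht : t ∉ 𝔮)
    (hmul : ∀ r ∈ I₂, t * r ∈ I₁) :
    I₁.map (algebraMap R Rq) = I₂.map (algebraMap R Rq) :=
  map_eq_map_of_forall_exists_mul_mem 𝔮 Rq hle fun r hr => ⟨t, ht, hmul r hr⟩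

/-- Special case: `I₂` inside the `t`-saturation of `I₁`, `t ∉ 𝔮`. [folklore] -/
theorem map_eq_map_of_pow_mul_mem {I₁ I₂ : Ideal R} (hle : I₁ ≤ I₂) (t : R) (ht : t ∉ 𝔮)
    (hsat : ∀ r ∈ I₂, ∃ m : ℕ, t ^ m * r ∈ I₁) :
    I₁.map (algebraMap R Rq) = I₂.map (algebraMap R Rq) :=
  map_eq_map_of_forall_exists_mul_mem 𝔮 Rq hle fun r hr => by
    obtain ⟨m, hm⟩ := hsat r hr
    exact ⟨t ^ m, fun h => ht (‹𝔮.IsPrime›.mem_of_pow_mem m h), hm⟩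

end Summit.ResolutionOfSingularities.ResolutionOfSingularities.Theorems.FRationalResolution.SaturatedIdealsLocalize

end
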